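import Summits.MatrixMultiplication.OmegaCensus.SmallFormats.MatMul225GF3CensusReduction
import Literature.Computability.AlgebraicComplexity.SubstitutionBacktracking
import HarnessLib

/-!
# ω-census family (a): ORBIT TRANSPORT — one representative per `GL₂ × GL₂ × T` orbit suffices

Cell `pub-omega` (unit `pub-omega-tensor`, gen 30), topic `Summits/MatrixMultiplication/OmegaCensus`
(sub-folder `SmallFormats`). Framing (verbatim): lottery ticket; floor = certified bounds/negative
ranges. HONEST FRAMING: the second typed REDUCTION step of the `𝔽₃` `⟨2,2,5⟩@17` X-marginal census
(the first is `eighteen_le_tensorRank_225_gf3_of_census`). The census enumerates X-marginals — the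
17 coefficient matrices `U_i = (f_i(E_{cd}))_{c,d}` of the X-forms — only UP TO re-indexing of the
products, per-term rescaling `U_i ↦ c_i U_i`, sandwiching `U_i ↦ P U_i Q` (`P, Q ∈ GL₂`) and transpose
`U_i ↦ U_iᵀ`; this file proves, for every field and every `⟨2,2,n⟩`, that REALISABILITY of a
marginal (some computation has exactly these coefficient matrices) is transported along each of these
moves (`exists_xMarginal_eq_reindex/_smul/_sandwich/_transpose`, composed in
`exists_xMarginal_eq_of_inOrbit`), hence:

* `eighteen_le_tensorRank_225_gf3_of_orbit_census`: IF every 17-product `𝔽₃`-computation of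
  `⟨2,2,5⟩` has its X-marginal in the orbit (`InOrbit`) of some member of a set `Reps` of
  representatives, AND no member of `Reps` is the X-marginal of a computation, THEN
  `18 ≤ R_𝔽₃(⟨2,2,5⟩)`;
* `eighteen_le_tensorRank_225_gf3_of_caps_census`: the same with the first hypothesis split into a
  KERNEL part (`Caps` holds for every computation's marginal — the X-cap system, proved elsewhere cap
  by cap) and the purely COMBINATORIAL enumeration fact (`every nowhere-zero marginal with Caps is in
  the orbit of a representative`).

Both hypotheses on `Reps` (enumeration complete: 62 018 orbits; every representative excluded) are
engine-side and are NOT asserted here. Nothing in this file is a bound on `ω` or the statement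
'R_𝔽₃(⟨2,2,5⟩) = 18'.
-/

namespace Summit.MatrixMultiplication.OmegaCensus.RankOnePlaneCapGeneral

open Module Matrix Literature.Computability.AlgebraicComplexity

/-- Transpose or not, by a Boolean flag (the orbit data of the census). -/
def transposeIf {k : Type*} (t : Bool) (M : Matrix (Fin 2) (Fin 2) k) : Matrix (Fin 2) (Fin 2) k :=
  if t then Mᵀ else M

/-- `transposeIf false` is the identity. -/
@[simp] theorem transposeIf_false {k : Type*} (M : Matrix (Fin 2) (Fin 2) k) : transposeIf false M = M := rfl

/-- `transposeIf true` is transpose. -/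
@[simp] theorem transposeIf_true {k : Type*} (M : Matrix (Fin 2) (Fin 2) k) : transposeIf true M = Mᵀ := rfl

variable {k : Type*} [Field k] {n : ℕ} {ι : Type*} [Fintype ι]

/-- The **X-marginal** of a computation of `⟨2,2,n⟩`: product `i` ↦ the coefficient matrix
`U_i c d = f_i(E_{cd})` of its X-form. -/
def xMarginal (β : BilinComp (mulBilin k 2 2 n) ι) (i : ι) : Matrix (Fin 2) (Fin 2) k :=
  Matrix.of fun c d => β.f i (Matrix.single c d (1 : k))

/-- Entries of the X-marginal. -/
@[simp] theorem xMarginal_apply (β : BilinComp (mulBilin k 2 2 n) ι) (i : ι) (c d : Fin 2) :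
    xMarginal β i c d = β.f i (Matrix.single c d (1 : k)) := rfl

/-- The X-form is recovered from its coefficient matrix: `f_i(X) = ∑_{c,d} X c d · U_i c d`. -/
theorem f_apply_eq_sum_xMarginal (β : BilinComp (mulBilin k 2 2 n) ι) (i : ι)
    (X : Matrix (Fin 2) (Fin 2) k) : β.f i X = ∑ c, ∑ d, X c d * xMarginal β i c d := by
  rw [dual_apply_eq_sum_single (β.f i) X]
  rfl

/-- Two computations with the same X-forms have the same X-marginal, and conversely. -/
theorem xMarginal_eq_iff (β β' : BilinComp (mulBilin k 2 2 n) ι) (i i' : ι) :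
    xMarginal β i = xMarginal β' i' ↔ β.f i = β'.f i' := by
  constructor
  · intro h
    ext X
    rw [f_apply_eq_sum_xMarginal, f_apply_eq_sum_xMarginal, h]
  · intro h
    ext c d
    rw [xMarginal_apply, xMarginal_apply, h]

/-- **Move 1: re-indexing.** Realisability of a marginal is invariant under permuting the products. -/
theorem exists_xMarginal_eq_reindex {ι' : Type*} [Fintype ι'] (β : BilinComp (mulBilin k 2 2 n) ι)
    (e : ι' ≃ ι) : ∃ β' : BilinComp (mulBilin k 2 2 n) ι', ∀ i, xMarginal β' i = xMarginal β (e i) :=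
  ⟨β.reindex e, fun _ => rfl⟩

/-- **Move 2: per-term rescaling** `U_i ↦ c_i U_i` (`c_i ≠ 0`; over `𝔽₃`: signs). -/
theorem exists_xMarginal_eq_smul (β : BilinComp (mulBilin k 2 2 n) ι) (c : ι → k)
    (hc : ∀ i, c i ≠ 0) :
    ∃ β' : BilinComp (mulBilin k 2 2 n) ι, ∀ i, xMarginal β' i = c i • xMarginal β i := by
  obtain ⟨β', hf, -, -⟩ := exists_rescale β c (fun i => (c i)⁻¹) fun i => mul_inv_cancel₀ (hc i)
  refine ⟨β', fun i => ?_⟩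
  ext a b
  simp [hf]

/-- **Move 3: sandwiching** `U_i ↦ P U_i Q` for invertible `P, Q` — realised by the X-side
`GL₂ × GL₂` action `X ↦ Pᵀ X Qᵀ` (`exists_XsideTransform`). -/
theorem exists_xMarginal_eq_sandwich (β : BilinComp (mulBilin k 2 2 n) ι)
    (P Q : Matrix (Fin 2) (Fin 2) k) (hP : P.det ≠ 0) (hQ : Q.det ≠ 0) :
    ∃ β' : BilinComp (mulBilin k 2 2 n) ι, ∀ i, xMarginal β' i = P * xMarginal β i * Q := by
  have hP' : IsUnit Pᵀ.det := by rw [Matrix.det_transpose]; exact isUnit_iff_ne_zero.mpr hP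
  have hQ' : IsUnit Qᵀ.det := by rw [Matrix.det_transpose]; exact isUnit_iff_ne_zero.mpr hQ
  obtain ⟨β', hf, -, -⟩ := exists_XsideTransform β Pᵀ Pᵀ⁻¹ Qᵀ Qᵀ⁻¹
    (Matrix.mul_nonsing_inv _ hP') (Matrix.nonsing_inv_mul _ hQ')
  refine ⟨β', fun i => ?_⟩
  ext a b
  rw [xMarginal_apply, hf, f_apply_eq_sum_xMarginal]
  -- both sides are `∑_c ∑_d P a c * U c d * Q d b`
  have h1 : ∀ c d : Fin 2, (Pᵀ * Matrix.single a b (1 : k) * Qᵀ) c d = P a c * Q d b := by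
    intro c d
    simp [Matrix.mul_apply, Matrix.transpose_apply, Matrix.single_apply, ite_and]
  simp_rw [h1]
  simp only [Matrix.mul_apply, Finset.sum_mul]
  rw [Finset.sum_comm]
  exact Finset.sum_congr rfl fun d _ => Finset.sum_congr rfl fun c _ => by ring

/-- **Move 4: transpose** `U_i ↦ U_iᵀ` — realised by the transpose-dual symmetry
`(X, Y, Z) ↦ (Xᵀ, Zᵀ, Yᵀ)` of `⟨2,2,n⟩` (`exists_transposeDual`). -/
theorem exists_xMarginal_eq_transpose (β : BilinComp (mulBilin k 2 2 n) ι) :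
    ∃ β' : BilinComp (mulBilin k 2 2 n) ι, ∀ i, xMarginal β' i = (xMarginal β i)ᵀ := by
  classical
  obtain ⟨β', hf⟩ := exists_transposeDual β
  refine ⟨β', fun i => ?_⟩
  ext a b
  rw [xMarginal_apply, hf, Matrix.transpose_single, Matrix.transpose_apply, xMarginal_apply]

/-- **The orbit relation of the census.** `rep` lies in the orbit of the marginal `m` if it arises
from `m` by a re-indexing `σ`, a sandwich `P · Q` (`det P, det Q ≠ 0`), an optional transpose and
per-term nonzero scalars `c_i` — exactly the moves the enumerator quotients by (`GL₂ × GL₂`,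
transpose, normalisation of every class to first nonzero entry `1`, multisets). -/
def InOrbit {r : ℕ} (m rep : Fin r → Matrix (Fin 2) (Fin 2) k) : Prop :=
  ∃ (P Q : Matrix (Fin 2) (Fin 2) k) (t : Bool) (σ : Equiv.Perm (Fin r)) (c : Fin r → k),
    P.det ≠ 0 ∧ Q.det ≠ 0 ∧ (∀ i, c i ≠ 0) ∧
    ∀ i, rep i = c i • transposeIf t (P * m (σ i) * Q)

/-- Every marginal lies in its own orbit. -/
theorem inOrbit_refl {r : ℕ} (m : Fin r → Matrix (Fin 2) (Fin 2) k) : InOrbit m m :=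
  ⟨1, 1, false, Equiv.refl _, fun _ => 1, by simp, by simp, fun _ => one_ne_zero, fun i => by simp⟩

/-- **Orbit transport.** If some computation has X-marginal `m` and `rep` lies in the orbit of `m`,
then some computation (same length) has X-marginal `rep`. -/
theorem exists_xMarginal_eq_of_inOrbit {r : ℕ} (β : BilinComp (mulBilin k 2 2 n) (Fin r))
    {rep : Fin r → Matrix (Fin 2) (Fin 2) k} (h : InOrbit (xMarginal β) rep) :
    ∃ β' : BilinComp (mulBilin k 2 2 n) (Fin r), xMarginal β' = rep := by
  obtain ⟨P, Q, t, σ, c, hP, hQ, hc, hrep⟩ := h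
  -- re-index, sandwich, (transpose), rescale
  obtain ⟨β₁, h₁⟩ := exists_xMarginal_eq_reindex β σ
  obtain ⟨β₂, h₂⟩ := exists_xMarginal_eq_sandwich β₁ P Q hP hQ
  have h₃ : ∃ β₃ : BilinComp (mulBilin k 2 2 n) (Fin r),
      ∀ i, xMarginal β₃ i = transposeIf t (P * xMarginal β (σ i) * Q) := by
    cases t with
    | false => exact ⟨β₂, fun i => by rw [transposeIf_false, h₂, h₁]⟩
    | true =>
        obtain ⟨β₃, h₃⟩ := exists_xMarginal_eq_transpose β₂
        exact ⟨β₃, fun i => by rw [transposeIf_true, h₃, h₂, h₁]⟩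
  obtain ⟨β₃, h₃⟩ := h₃
  obtain ⟨β₄, h₄⟩ := exists_xMarginal_eq_smul β₃ c hc
  exact ⟨β₄, funext fun i => by rw [h₄, h₃, hrep]⟩

/-- **Census reduction, orbit form.** IF every 17-product `𝔽₃`-computation of `⟨2,2,5⟩` has its
X-marginal in the orbit of some member of `Reps` (enumeration complete — engine-side: the 62 018
representatives), AND no member of `Reps` is the X-marginal of a 17-product computation (every
representative excluded — engine-side), THEN `18 ≤ R_𝔽₃(⟨2,2,5⟩)` (`= 18` with the Hopcroft–Kerr
ceiling `tensorRank_matMulTensor_225_gf3_mem`). Neither hypothesis is proved here. -/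
theorem eighteen_le_tensorRank_225_gf3_of_orbit_census
    (Reps : Set (Fin 17 → Matrix (Fin 2) (Fin 2) (ZMod 3)))
    (hcover : ∀ β : BilinComp (mulBilin (ZMod 3) 2 2 5) (Fin 17),
      ∃ rep ∈ Reps, InOrbit (xMarginal β) rep)
    (hexcl : ∀ rep ∈ Reps, ∀ β : BilinComp (mulBilin (ZMod 3) 2 2 5) (Fin 17), xMarginal β ≠ rep) :
    18 ≤ tensorRank (matMulTensor (ZMod 3) 2 2 5) := by
  by_contra hlt
  obtain ⟨β⟩ := exists_bilinComp_of_tensorRank_le (k := ZMod 3) (c := 2) (m := 2) (n := 5)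
    (r := 17) (by omega)
  obtain ⟨rep, hrep, horb⟩ := hcover β
  obtain ⟨β', hβ'⟩ := exists_xMarginal_eq_of_inOrbit β horb
  exact hexcl rep hrep β' hβ'

/-- In a 17-product `𝔽₃`-computation of `⟨2,2,5⟩` every coefficient matrix of the X-marginal is
nonzero (`f_ne_zero_of_card_seventeen`: a dead product would leave 16, below the kernel floor 17). -/
theorem xMarginal_ne_zero_of_card_seventeen (β : BilinComp (mulBilin (ZMod 3) 2 2 5) (Fin 17))
    (i : Fin 17) : xMarginal β i ≠ 0 := by
  intro h
  apply f_ne_zero_of_card_seventeen (by simp) β i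
  ext X
  rw [f_apply_eq_sum_xMarginal, h]
  simp

/-- **Census reduction, caps form.** With `Caps` any property of marginals that EVERY 17-product
`𝔽₃`-computation of `⟨2,2,5⟩` satisfies (the kernel X-cap system, proved cap by cap elsewhere), the
enumeration hypothesis becomes purely combinatorial: every nowhere-zero marginal with `Caps` lies in
the orbit of a representative. Together with the exclusion of every representative this gives
`18 ≤ R_𝔽₃(⟨2,2,5⟩)`. The two hypotheses on `Reps` are engine-side and NOT proved here. -/
theorem eighteen_le_tensorRank_225_gf3_of_caps_census
    (Caps : (Fin 17 → Matrix (Fin 2) (Fin 2) (ZMod 3)) → Prop)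
    (hcaps : ∀ β : BilinComp (mulBilin (ZMod 3) 2 2 5) (Fin 17), Caps (xMarginal β))
    (Reps : Set (Fin 17 → Matrix (Fin 2) (Fin 2) (ZMod 3)))
    (henum : ∀ m : Fin 17 → Matrix (Fin 2) (Fin 2) (ZMod 3), (∀ i, m i ≠ 0) → Caps m →
      ∃ rep ∈ Reps, InOrbit m rep)
    (hexcl : ∀ rep ∈ Reps, ∀ β : BilinComp (mulBilin (ZMod 3) 2 2 5) (Fin 17), xMarginal β ≠ rep) :
    18 ≤ tensorRank (matMulTensor (ZMod 3) 2 2 5) :=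
  eighteen_le_tensorRank_225_gf3_of_orbit_census Reps
    (fun β => henum _ (xMarginal_ne_zero_of_card_seventeen β) (hcaps β)) hexcl

/-- **Exclusion travels along the orbit.** If `rep` lies in the orbit of `m` and NO computation of the
given length has X-marginal `rep`, then no computation has X-marginal `m` (contrapositive of
`exists_xMarginal_eq_of_inOrbit`; e.g. an orbit is excluded as soon as its transpose partner is). -/
theorem forall_xMarginal_ne_of_inOrbit {r : ℕ} {m rep : Fin r → Matrix (Fin 2) (Fin 2) k}
    (h : InOrbit m rep) (hrep : ∀ β : BilinComp (mulBilin k 2 2 n) (Fin r), xMarginal β ≠ rep) :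
    ∀ β : BilinComp (mulBilin k 2 2 n) (Fin r), xMarginal β ≠ m := by
  intro β hβ
  obtain ⟨β', hβ'⟩ := exists_xMarginal_eq_of_inOrbit β (hβ ▸ h)
  exact hrep β' hβ'

/-- The transpose partner: `i ↦ (m i)ᵀ` lies in the orbit of `m` (data `P = Q = 1`, `t = true`,
`σ = 1`, `c = 1`). -/
theorem inOrbit_transpose {r : ℕ} (m : Fin r → Matrix (Fin 2) (Fin 2) k) :
    InOrbit m (fun i => (m i)ᵀ) :=
  ⟨1, 1, true, Equiv.refl _, fun _ => 1, by simp, by simp, fun _ => one_ne_zero, fun i => by simp⟩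

/-- Hence a marginal is excluded as soon as its transpose is: if no computation of length `r` has
X-marginal `i ↦ (m i)ᵀ`, none has X-marginal `m`. -/
theorem forall_xMarginal_ne_of_transpose {r : ℕ} {m : Fin r → Matrix (Fin 2) (Fin 2) k}
    (hT : ∀ β : BilinComp (mulBilin k 2 2 n) (Fin r), xMarginal β ≠ fun i => (m i)ᵀ) :
    ∀ β : BilinComp (mulBilin k 2 2 n) (Fin r), xMarginal β ≠ m :=
  forall_xMarginal_ne_of_inOrbit (inOrbit_transpose m) hT

/-! ## `InOrbit` is an equivalence relation -/

/-- `transposeIf` of a transpose flips the flag's effect: `T^t(Mᵀ) = (T^t M)ᵀ`. -/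
theorem transposeIf_transpose {k : Type*} (t : Bool) (M : Matrix (Fin 2) (Fin 2) k) :
    transposeIf t Mᵀ = (transposeIf t M)ᵀ := by
  cases t <;> rfl

/-- **Symmetry.** If `rep` lies in the orbit of `m` then `m` lies in the orbit of `rep` (inverse data:
`σ⁻¹`, `c⁻¹`, and `P⁻¹ · Q⁻¹` resp. `Q⁻ᵀ · P⁻ᵀ` according to the transpose flag). -/
theorem InOrbit.symm {r : ℕ} {m rep : Fin r → Matrix (Fin 2) (Fin 2) k} (h : InOrbit m rep) :
    InOrbit rep m := by
  obtain ⟨P, Q, t, σ, c, hP, hQ, hc, hrep⟩ := h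
  have hPu : IsUnit P.det := isUnit_iff_ne_zero.mpr hP
  have hQu : IsUnit Q.det := isUnit_iff_ne_zero.mpr hQ
  have hPi : P⁻¹.det ≠ 0 := ((Matrix.isUnit_nonsing_inv_det_iff).mpr hPu).ne_zero
  have hQi : Q⁻¹.det ≠ 0 := ((Matrix.isUnit_nonsing_inv_det_iff).mpr hQu).ne_zero
  -- solve the defining identity for `m (σ i)`
  have key : ∀ i, m (σ i) = (c i)⁻¹ • (P⁻¹ * transposeIf t (rep i) * Q⁻¹) := by
    intro i
    have h1 : transposeIf t (rep i) = c i • (P * m (σ i) * Q) := by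
      rw [hrep i]
      cases t
      · simp
      · simp [Matrix.transpose_smul]
    rw [h1, Matrix.mul_smul, Matrix.smul_mul, smul_smul, inv_mul_cancel₀ (hc i), one_smul,
      ← Matrix.mul_assoc, ← Matrix.mul_assoc, Matrix.nonsing_inv_mul _ hPu, Matrix.one_mul,
      Matrix.mul_assoc, Matrix.mul_nonsing_inv _ hQu, Matrix.mul_one]
  cases t with
  | false =>
      refine ⟨P⁻¹, Q⁻¹, false, σ.symm, fun j => (c (σ.symm j))⁻¹, hPi, hQi,
        fun j => inv_ne_zero (hc _), fun j => ?_⟩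
      have := key (σ.symm j)
      rw [Equiv.apply_symm_apply] at this
      rw [this]
      simp only [transposeIf_false, Matrix.mul_assoc]
  | true =>
      refine ⟨Q⁻¹ᵀ, P⁻¹ᵀ, true, σ.symm, fun j => (c (σ.symm j))⁻¹, by rwa [Matrix.det_transpose],
        by rwa [Matrix.det_transpose], fun j => inv_ne_zero (hc _), fun j => ?_⟩
      have := key (σ.symm j)
      rw [Equiv.apply_symm_apply] at this
      rw [this]
      simp only [transposeIf_true, Matrix.transpose_mul, Matrix.transpose_transpose, Matrix.mul_assoc]

/-- **Transitivity.** Orbit data compose (the transpose flags add mod 2). -/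
theorem InOrbit.trans {r : ℕ} {m m' m'' : Fin r → Matrix (Fin 2) (Fin 2) k} (h : InOrbit m m')
    (h' : InOrbit m' m'') : InOrbit m m'' := by
  obtain ⟨P, Q, t, σ, c, hP, hQ, hc, h1⟩ := h
  obtain ⟨P', Q', t', σ', c', hP', hQ', hc', h2⟩ := h'
  have hcc : ∀ i, c' i * c (σ' i) ≠ 0 := fun i => mul_ne_zero (hc' i) (hc _)
  -- m'' i = c' i • T^{t'} (P' (c (σ' i) • T^t (P m (σ (σ' i)) Q)) Q')
  have key : ∀ i, m'' i = (c' i * c (σ' i)) • transposeIf t' (P' * transposeIf t (P * m (σ (σ' i)) * Q) * Q') := by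
    intro i
    rw [h2 i, h1 (σ' i), Matrix.mul_smul, Matrix.smul_mul, ← smul_smul]
    congr 1
    cases t' <;> simp [Matrix.transpose_smul]
  cases t with
  | false =>
      refine ⟨P' * P, Q * Q', t', σ'.trans σ, fun i => c' i * c (σ' i), ?_, ?_, hcc, fun i => ?_⟩
      · rw [Matrix.det_mul]; exact mul_ne_zero hP' hP
      · rw [Matrix.det_mul]; exact mul_ne_zero hQ hQ'
      · rw [key i, transposeIf_false]
        simp only [Equiv.trans_apply, Matrix.mul_assoc]
  | true =>
      cases t' with
      | false =>
          refine ⟨Q'ᵀ * P, Q * P'ᵀ, true, σ'.trans σ, fun i => c' i * c (σ' i), ?_, ?_, hcc,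
            fun i => ?_⟩
          · rw [Matrix.det_mul, Matrix.det_transpose]; exact mul_ne_zero hQ' hP
          · rw [Matrix.det_mul, Matrix.det_transpose]; exact mul_ne_zero hQ hP'
          · rw [key i, transposeIf_false, transposeIf_true, transposeIf_true]
            simp only [Equiv.trans_apply, Matrix.transpose_mul,
              Matrix.transpose_transpose, Matrix.mul_assoc]
      | true =>
          refine ⟨Q'ᵀ * P, Q * P'ᵀ, false, σ'.trans σ, fun i => c' i * c (σ' i), ?_, ?_, hcc,
            fun i => ?_⟩
          · rw [Matrix.det_mul, Matrix.det_transpose]; exact mul_ne_zero hQ' hP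
          · rw [Matrix.det_mul, Matrix.det_transpose]; exact mul_ne_zero hQ hP'
          · rw [key i, transposeIf_true, transposeIf_true, transposeIf_false]
            simp only [Equiv.trans_apply, Matrix.transpose_mul,
              Matrix.transpose_transpose, Matrix.mul_assoc]

/-- Hence two marginals in one orbit are realisable together or not at all. -/
theorem exists_xMarginal_eq_iff_of_inOrbit {r : ℕ} {m rep : Fin r → Matrix (Fin 2) (Fin 2) k}
    (h : InOrbit m rep) :
    (∃ β : BilinComp (mulBilin k 2 2 n) (Fin r), xMarginal β = m) ↔
      ∃ β : BilinComp (mulBilin k 2 2 n) (Fin r), xMarginal β = rep := by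
  constructor
  · rintro ⟨β, hβ⟩
    exact exists_xMarginal_eq_of_inOrbit β (hβ ▸ h)
  · rintro ⟨β, hβ⟩
    exact exists_xMarginal_eq_of_inOrbit β (hβ ▸ h.symm)

end Summit.MatrixMultiplication.OmegaCensus.RankOnePlaneCapGeneral
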